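import Summits.QuantumFields.BalabanUV.T4Continuum.Support.RegionFaceFluxChart

/-!
# T⁴ programme, spine node NE2 (U1a), sub-row Δ1 «NE2⁰-Dirichlet» — THE DISCRETE TRACE INEQUALITY ON THE DEFICIENT STAR BONDS
# and the bound `‖Δ_a(Ω₀)⁻¹·P_def‖ ≤ √((2γ⁻¹ + CgI)·γ⁻¹/n)` from W1 + interior W2

NE2 formalisation swarm `b2b-balaban-t4-ne2-formalise-*`, LEAF PROVER 06 (gen 6), supplier item «Δ1-VEC-W3̃-TRACE» (journal
2026-08-20 l.20563), file 1 of 3.  Context: the owner's renormalised star tower (`DirichletSubregionRenormTower` p228571 /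
`DirichletStarRenormTower` p228905) plants a coarse star bond on its `nch` star children with weight `nch^{−1/2}`; by
`DirichletStarSlabLayer.nch_eq` (leaf-02-g7) `nch = L^d` on REGULAR star bonds (base point in `Ω`) and `nch = L^{d−1}` on the
DEFICIENT ones — the INWARD SPIKES `(x,ν)`, `x ∉ Ω`, `x + e_ν ∈ Ω`.  Leaf-02-g7's no-go (`DirichletStarRenormSlabNoGo`) shows the
renormalised injected law W3̃ fails at the torus rate off `⊤` because of these spikes.  THIS FILE supplies the matching UPPER bound's
analytic input:

 * §1 a 1D averaged path inequality `n·‖w 0‖² ≤ 2·Σ_{s<n} ‖w s‖² + n²·Σ_{r<n−1} ‖w (r+1) − w r‖²`;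
 * §2 the geometry of the column of `n` consecutive star bonds rising from an inward spike into its block (block, digit, star
   membership; distinct spikes have disjoint columns);
 * §3 **THE TRACE INEQUALITY** `trace_deficient_le`: for EVERY union of blocks `S`, every `n ≥ 1`, every star-bond field `u`,
   `Σ_{deficient b} ‖u b‖² ≤ (2·nsq u + Σ_ν nsq (igrad_ν u)) / n` — no hypothesis;
 * §4 the diagonal indicator `defP` of the deficient bonds and **`opNorm_inv_mul_defP_le`**: for a Hermitian `D` on the star bonds
   with `Coercive D γ` (W1) and the interior gradient-form bound `Σ_μ nsq (igrad_μ w) ≤ CgI·Re⟨w, D w⟩` (interior W2, leaf-07-g7's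
   shape), `‖D⁻¹·defP‖ ≤ √((2γ⁻¹ + CgI)·γ⁻¹ / n)` — the Green function of a normalised surface-layer charge has `ℓ²`-size `n^{−1/2}`.

Files 2/3 (`DirichletStarRenormReduction`, `DirichletStarRenormBoxTower`) turn this into `‖(G′J̃ − J̃G) − (G′J − JG)·N‖ ≤ C·n_k^{−1/2}`
(`J̃ = J·N`) and the box star tower modulo King's compressed injected law only.

HONEST FRAMING (T4-DAG p. 1).  [folklore] finite lattice calculus on the cell's typed `U = 1` objects (one region, one averaging
scale, finite torus, operator norm); constants OURS; W1 / interior W2 enter §4 as DISPLAYED hypotheses (theorems on product regions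
elsewhere in the tree); nothing printed is a hypothesis or a conclusion; W3 NOT proved; Δ1 NOT closed; NE2 (U1a) NOT proved; spine
PROVED 0/9 unchanged; NOT [B9] (3.16)/(3.23)–(3.27) as printed; NOT infinite volume / mass gap / Clay.  HONEST DEPENDENCY: continuum YM
on T⁴ ⇐ BetaPertH ∧ nine spine estimates (0/9 proved); BetaPertH ⇐ (D1) ∧ (D4) ∧ CAP+tail; G-an2-4 gates asym, D1 and NE2/3/4.  No
`sorry`.
-/

noncomputable section

open scoped BigOperators ComplexConjugate Matrix Matrix.Norms.L2Operator
open Finset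

namespace Summit.QuantumFields.BalabanUV.T4Continuum.RegionStarTrace

open Literature.MathematicalPhysics.QuantumFieldTheory.Balaban1983to89.B5Prop11Plancherel (Tor fine unitVec opNorm_le_of_sq_le)
open Literature.MathematicalPhysics.QuantumFieldTheory.Balaban1983to89.B5Prop11Lower (nsq nsq_nonneg norm_star_dotProduct_le)
open Literature.MathematicalPhysics.QuantumFieldTheory.Balaban1983to89.B5Block118 (bpt tstep tstep_zero tstep_succ)
open Literature.MathematicalPhysics.QuantumFieldTheory.Balaban1983to89.B5Blocks16 (blockOf blockOf_bpt)
open Summit.QuantumFields.BalabanUV.T4Continuum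
open Summit.QuantumFields.BalabanUV.T4Continuum.SubtypeCompression (ext ext_apply_of ext_apply_of_not nsq_ext Coercive
  isUnit_det_of_coercive)
open Summit.QuantumFields.BalabanUV.T4Continuum.ScalarBlockTrialFunction (digits digits_bpt bpt_add_unitVec_of_eq)
open Summit.QuantumFields.BalabanUV.T4Continuum.RegionGaugeFixedVector (starReg)
open Summit.QuantumFields.BalabanUV.T4Continuum.RegionGaugeFixedVectorFlat (bpt_blockOf_digits)
open Summit.QuantumFields.BalabanUV.T4Continuum.DirichletStarVectorTower (digit_eq_of_blockOf_ne)
open Summit.QuantumFields.BalabanUV.T4Continuum.DirichletStarRenormTower (igrad)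
open Summit.QuantumFields.BalabanUV.T4Continuum.RegionFaceFluxChart (col col_of_lt gI gI_nonneg sum_gI_eq gI_eq_of_star
  norm_sub_sq_le_path)
open Summit.QuantumFields.BalabanUV.Beta.GAN24.DirichletBoxTrace (blockReg)

/-! ## §1 The averaged path inequality on a column -/

/-- `‖a‖² ≤ 2‖b‖² + 2‖b − a‖²`. [folklore] -/
theorem norm_sq_le_two (a b : ℂ) : ‖a‖ ^ 2 ≤ 2 * ‖b‖ ^ 2 + 2 * ‖b - a‖ ^ 2 := by
  have h : ‖a‖ ≤ ‖b‖ + ‖b - a‖ := by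
    calc ‖a‖ = ‖b - (b - a)‖ := by rw [sub_sub_cancel]
      _ ≤ ‖b‖ + ‖b - a‖ := norm_sub_le _ _
  nlinarith [norm_nonneg a, norm_nonneg b, norm_nonneg (b - a), sq_nonneg (‖b‖ - ‖b - a‖)]

/-- **THE AVERAGED PATH INEQUALITY**: `n·‖w 0‖² ≤ 2·Σ_{s<n} ‖w s‖² + n²·Σ_{r<n−1} ‖w (r+1) − w r‖²` (value at the foot of a column
of `n` sites against the column's mass and its consecutive differences). [folklore] -/
theorem path_avg (w : ℕ → ℂ) (n : ℕ) :
    (n : ℝ) * ‖w 0‖ ^ 2 ≤ 2 * ∑ s ∈ range n, ‖w s‖ ^ 2 + (n : ℝ) ^ 2 * ∑ r ∈ range (n - 1), ‖w (r + 1) - w r‖ ^ 2 := by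
  set Δ := ∑ r ∈ range (n - 1), ‖w (r + 1) - w r‖ ^ 2 with hΔ
  have hΔ0 : 0 ≤ Δ := sum_nonneg fun r _ => by positivity
  -- each height: `‖w 0‖² ≤ 2‖w s‖² + 2 s Δ`
  have hs : ∀ s ∈ range n, ‖w 0‖ ^ 2 ≤ 2 * ‖w s‖ ^ 2 + 2 * ((s : ℝ) * Δ) := by
    intro s hs
    have hsn : s < n := mem_range.mp hs
    have hp := norm_sub_sq_le_path w (Nat.zero_le s)
    have hsub : ∑ r ∈ Ico 0 s, ‖w (r + 1) - w r‖ ^ 2 ≤ Δ := by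
      rw [hΔ, Nat.Ico_zero_eq_range]
      exact sum_le_sum_of_subset_of_nonneg (range_subset_range.mpr (Nat.le_sub_one_of_lt hsn)) fun _ _ _ => by positivity
    have h1 : ‖w s - w 0‖ ^ 2 ≤ (s : ℝ) * Δ := by
      rw [Nat.sub_zero] at hp
      exact hp.trans (mul_le_mul_of_nonneg_left hsub (Nat.cast_nonneg s))
    linarith [norm_sq_le_two (w 0) (w s)]
  have hsum := sum_le_sum hs
  rw [sum_const, card_range, nsmul_eq_mul, sum_add_distrib, ← mul_sum, ← mul_sum, ← sum_mul] at hsum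
  have hgauss : ∑ s ∈ range n, (s : ℝ) ≤ (n : ℝ) ^ 2 / 2 := by
    have h := Finset.sum_range_id_mul_two n
    have h' : ((∑ s ∈ range n, s : ℕ) : ℝ) * 2 = (n : ℝ) * ((n : ℝ) - 1 : ℝ) := by
      have hn : ((n * (n - 1) : ℕ) : ℝ) = (n : ℝ) * ((n : ℝ) - 1) := by
        rcases Nat.eq_zero_or_pos n with h0 | hpos
        · subst h0; simp
        · rw [Nat.cast_mul, Nat.cast_sub hpos, Nat.cast_one]
      rw [← hn, ← h]; push_cast; ring
    rw [Nat.cast_sum] at h'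
    nlinarith [h']
  calc (n : ℝ) * ‖w 0‖ ^ 2 ≤ 2 * ∑ s ∈ range n, ‖w s‖ ^ 2 + 2 * ((∑ s ∈ range n, (s : ℝ)) * Δ) := hsum
    _ ≤ 2 * ∑ s ∈ range n, ‖w s‖ ^ 2 + (n : ℝ) ^ 2 * Δ := by nlinarith [mul_le_mul_of_nonneg_right hgauss hΔ0]

/-! ## §2 The column rising from an inward spike -/

section Column

variable {d : ℕ} (n : ℕ) [NeZero n] (M : Fin d → ℕ) [hM : ∀ μ, NeZero (M μ)] (S : Tor M → Prop)

/-- a DEFICIENT star bond `(x,ν)` (`x ∉ Ω`) points INTO `Ω`: `x + e_ν ∈ Ω`. [folklore] -/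
theorem blockReg_add_of_deficient {b : Tor (fine n M) × Fin d} (hb : starReg n M S b) (hx : ¬ blockReg n M S b.1) :
    blockReg n M S (b.1 + unitVec (fine n M) b.2) := hb.resolve_left hx

/-- its base point sits in the LAST `ν`-layer of its own block. [folklore] -/
theorem digit_of_deficient {b : Tor (fine n M) × Fin d} (hb : starReg n M S b) (hx : ¬ blockReg n M S b.1) :
    (digits n M b.1 b.2 : ℕ) + 1 = n := by
  refine digit_eq_of_blockOf_ne n M b.1 b.2 fun h => hx ?_
  have h1 := blockReg_add_of_deficient n M S hb hx
  unfold blockReg at h1 ⊢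
  rwa [h] at h1

/-- **THE COLUMN CHART**: the site at height `r + 1` above the spike base is the height-`r` site of the `ν`-column of the block
`blockOf x + e_ν` through the digits of `x`. [folklore] -/
theorem add_tstep_succ_eq_col {b : Tor (fine n M) × Fin d} (hb : starReg n M S b) (hx : ¬ blockReg n M S b.1) (r : ℕ) :
    b.1 + tstep (fine n M) b.2 (r + 1) = col n M b.2 (blockOf n M b.1 + unitVec M b.2) (digits n M b.1) r := by
  have hstep : b.1 + unitVec (fine n M) b.2 = bpt n M (blockOf n M b.1 + unitVec M b.2) (Function.update (digits n M b.1) b.2 0) := by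
    conv_lhs => rw [← bpt_blockOf_digits n M b.1]
    exact bpt_add_unitVec_of_eq n M _ _ b.2 (digit_of_deficient n M S hb hx)
  rw [col, ← hstep, tstep_succ, ← add_assoc, add_right_comm]

/-- heights `1, …, n` above the spike base lie in the block `blockOf x + e_ν`. [folklore] -/
theorem blockOf_add_tstep_succ {b : Tor (fine n M) × Fin d} (hb : starReg n M S b) (hx : ¬ blockReg n M S b.1) {r : ℕ} (hr : r < n) :
    blockOf n M (b.1 + tstep (fine n M) b.2 (r + 1)) = blockOf n M b.1 + unitVec M b.2 := by
  rw [add_tstep_succ_eq_col n M S hb hx r, col_of_lt n M b.2 _ _ hr, blockOf_bpt]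

omit [NeZero n] hM in
/-- one unit step is the height-`1` column step. [folklore] -/
theorem add_unitVec_eq_add_tstep_one (x : Tor (fine n M)) (ν : Fin d) :
    x + unitVec (fine n M) ν = x + tstep (fine n M) ν (0 + 1) := by
  rw [tstep_succ, tstep_zero, zero_add]

/-- the block `blockOf x + e_ν` is a block of `S`. [folklore] -/
theorem S_blockOf_add {b : Tor (fine n M) × Fin d} (hb : starReg n M S b) (hx : ¬ blockReg n M S b.1) :
    S (blockOf n M b.1 + unitVec M b.2) := by
  have h1 := blockReg_add_of_deficient n M S hb hx
  unfold blockReg at h1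
  rwa [add_unitVec_eq_add_tstep_one n M, blockOf_add_tstep_succ n M S hb hx (Nat.pos_of_ne_zero (NeZero.ne n))] at h1

/-- heights `1, …, n` above the spike base lie in `Ω`. [folklore] -/
theorem blockReg_add_tstep_succ {b : Tor (fine n M) × Fin d} (hb : starReg n M S b) (hx : ¬ blockReg n M S b.1) {r : ℕ} (hr : r < n) :
    blockReg n M S (b.1 + tstep (fine n M) b.2 (r + 1)) := by
  unfold blockReg
  rw [blockOf_add_tstep_succ n M S hb hx hr]
  exact S_blockOf_add n M S hb hx

/-- the `ν`-digit at height `r + 1` is `r`. [folklore] -/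
theorem digit_add_tstep_succ {b : Tor (fine n M) × Fin d} (hb : starReg n M S b) (hx : ¬ blockReg n M S b.1) {r : ℕ} (hr : r < n) :
    (digits n M (b.1 + tstep (fine n M) b.2 (r + 1)) b.2 : ℕ) = r := by
  rw [add_tstep_succ_eq_col n M S hb hx r, col_of_lt n M b.2 _ _ hr, digits_bpt, Function.update_self]

/-- **THE COLUMN IS MADE OF STAR BONDS**: heights `0, …, n` above the spike base carry star bonds. [folklore] -/
theorem star_add_tstep {b : Tor (fine n M) × Fin d} (hb : starReg n M S b) (hx : ¬ blockReg n M S b.1) {s : ℕ} (hs : s ≤ n) :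
    starReg n M S (b.1 + tstep (fine n M) b.2 s, b.2) := by
  rcases s with _ | r
  · rw [tstep_zero, add_zero]; exact hb
  · exact Or.inl (blockReg_add_tstep_succ n M S hb hx (by omega))

/-- **DISTINCT SPIKES HAVE DISJOINT COLUMNS**: `(b, s) ↦ (x_b + s·e_{ν_b}, ν_b)` is injective on deficient bonds × heights `< n`.
[folklore] -/
theorem column_inj {b b' : Tor (fine n M) × Fin d} (hb : starReg n M S b) (hx : ¬ blockReg n M S b.1) (hb' : starReg n M S b')
    (hx' : ¬ blockReg n M S b'.1) {s s' : ℕ} (hs : s < n) (hs' : s' < n)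
    (h : (b.1 + tstep (fine n M) b.2 s, b.2) = (b'.1 + tstep (fine n M) b'.2 s', b'.2)) : b = b' ∧ s = s' := by
  obtain ⟨h1, h2⟩ := Prod.mk.inj h
  rcases s with _ | r <;> rcases s' with _ | r'
  · rw [tstep_zero, tstep_zero, add_zero, add_zero] at h1
    exact ⟨Prod.ext h1 h2, rfl⟩
  · exfalso; apply hx
    rw [tstep_zero, add_zero] at h1
    rw [h1]; exact blockReg_add_tstep_succ n M S hb' hx' (by omega)
  · exfalso; apply hx'
    rw [tstep_zero, add_zero] at h1
    rw [← h1]; exact blockReg_add_tstep_succ n M S hb hx (by omega)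
  · have hd := digit_add_tstep_succ n M S hb hx (r := r) (by omega)
    have hd' := digit_add_tstep_succ n M S hb' hx' (r := r') (by omega)
    rw [h1, h2, hd'] at hd
    subst hd
    rw [h2] at h1
    exact ⟨Prod.ext (add_right_cancel h1) h2, rfl⟩

end Column

/-! ## §3 The trace inequality -/

section Trace

variable {d : ℕ} (n : ℕ) [NeZero n] (M : Fin d → ℕ) [hM : ∀ μ, NeZero (M μ)] (S : Tor M → Prop) [DecidablePred S]

omit hM in
/-- the bond at height `s` of the column above `b = (x, ν)`: `(x + s·e_ν, ν)`. [folklore] -/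
def cpt (b : Tor (fine n M) × Fin d) (s : ℕ) : Tor (fine n M) × Fin d := (b.1 + tstep (fine n M) b.2 s, b.2)

omit [NeZero n] hM in
/-- one step up the column. [folklore] -/
theorem cpt_succ (b : Tor (fine n M) × Fin d) (r : ℕ) :
    cpt n M b (r + 1) = ((cpt n M b r).1 + unitVec (fine n M) b.2, b.2) := by
  unfold cpt; rw [tstep_succ, add_assoc]

/-- the DEFICIENT star bonds: those whose base point is outside `Ω` (the inward spikes). [folklore] -/
def defSet : Finset {b // starReg n M S b} := univ.filter fun b => ¬ blockReg n M S b.1.1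

/-- membership in `defSet`. [folklore] -/
theorem mem_defSet {b : {b // starReg n M S b}} : b ∈ defSet n M S ↔ ¬ blockReg n M S b.1.1 := by
  simp [defSet]

/-- **ONE SPIKE**: `n·‖u b‖² ≤ 2·Σ_{s<n} ‖ιu (x + s e_ν, ν)‖² + Σ_{r<n} gI_ν u (x + r e_ν, ν)` for a deficient star bond `b = (x,ν)`.
[folklore] -/
theorem spike_le (u : {b // starReg n M S b} → ℂ) (b : {b // starReg n M S b}) (hx : ¬ blockReg n M S b.1.1) :
    (n : ℝ) * ‖u b‖ ^ 2 ≤ 2 * ∑ s ∈ range n, ‖ext (starReg n M S) u (cpt n M b.1 s)‖ ^ 2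
      + ∑ r ∈ range n, gI n M S b.1.2 u (cpt n M b.1 r) := by
  have hp := path_avg (fun s => ext (starReg n M S) u (cpt n M b.1 s)) n
  have h0 : ext (starReg n M S) u (cpt n M b.1 0) = u b := by
    have e : cpt n M b.1 0 = b.1 := by unfold cpt; rw [tstep_zero, add_zero]
    rw [e]; exact ext_apply_of _ u b
  simp only [h0] at hp
  have hdiff : ∀ r ∈ range (n - 1), (n : ℝ) ^ 2 * ‖ext (starReg n M S) u (cpt n M b.1 (r + 1)) - ext (starReg n M S) u (cpt n M b.1 r)‖ ^ 2
      = gI n M S b.1.2 u (cpt n M b.1 r) := by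
    intro r hr
    have hr' : r + 1 ≤ n := by have := mem_range.mp hr; omega
    have hc : starReg n M S (cpt n M b.1 r) := star_add_tstep n M S b.2 hx (by omega)
    have hc' : starReg n M S ((cpt n M b.1 r).1 + unitVec (fine n M) b.1.2, (cpt n M b.1 r).2) := by
      have e : ((cpt n M b.1 r).1 + unitVec (fine n M) b.1.2, (cpt n M b.1 r).2) = cpt n M b.1 (r + 1) := (cpt_succ n M b.1 r).symm
      rw [e]; exact star_add_tstep n M S b.2 hx hr'
    rw [gI_eq_of_star n M S b.1.2 u (cpt n M b.1 r) hc hc', cpt_succ]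
    rfl
  have hsum : (n : ℝ) ^ 2 * ∑ r ∈ range (n - 1), ‖ext (starReg n M S) u (cpt n M b.1 (r + 1)) - ext (starReg n M S) u (cpt n M b.1 r)‖ ^ 2
      ≤ ∑ r ∈ range n, gI n M S b.1.2 u (cpt n M b.1 r) := by
    rw [mul_sum, sum_congr rfl hdiff]
    exact sum_le_sum_of_subset_of_nonneg (range_subset_range.mpr (Nat.sub_le n 1)) fun _ _ _ => gI_nonneg n M S _ u _
  linarith

/-- distinct (deficient bond, height `< n`) pairs give distinct column bonds. [folklore] -/
theorem cpt_injOn : Set.InjOn (fun p : {b // starReg n M S b} × ℕ => cpt n M p.1.1 p.2) ↑(defSet n M S ×ˢ range n) := by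
  rintro ⟨b, s⟩ hbs ⟨b', s'⟩ hbs' h
  rw [Finset.coe_product, Set.mem_prod, Finset.mem_coe, mem_defSet, Finset.mem_coe, mem_range] at hbs hbs'
  obtain ⟨h1, h2⟩ := column_inj n M S b.2 hbs.1 b'.2 hbs'.1 hbs.2 hbs'.2 h
  exact Prod.ext (Subtype.ext h1) h2

/-- summing a NON-NEGATIVE bond function over all columns of all spikes counts every bond at most once. [folklore] -/
theorem sum_columns_le (F : Tor (fine n M) × Fin d → ℝ) (hF : ∀ c, 0 ≤ F c) :
    ∑ b ∈ defSet n M S, ∑ s ∈ range n, F (cpt n M b.1 s) ≤ ∑ c, F c := by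
  rw [← sum_product (s := defSet n M S) (t := range n) (f := fun p => F (cpt n M p.1.1 p.2)),
    ← sum_image (f := F) (g := fun p : {b // starReg n M S b} × ℕ => cpt n M p.1.1 p.2) (cpt_injOn n M S)]
  exact sum_le_sum_of_subset_of_nonneg (subset_univ _) fun c _ _ => hF c

/-- **THE DISCRETE TRACE INEQUALITY ON THE INWARD SPIKES** of an arbitrary union of blocks, at every level `n ≥ 1`, for every
star-bond field: `Σ_{deficient b} ‖u b‖² ≤ (2·nsq u + Σ_ν nsq (igrad_ν u)) / n`. [folklore] -/
theorem trace_deficient_le (u : {b // starReg n M S b} → ℂ) :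
    ∑ b ∈ defSet n M S, ‖u b‖ ^ 2 ≤ (2 * nsq u + ∑ ν, nsq (igrad M S n ν u)) / n := by
  have hn : (0 : ℝ) < n := by exact_mod_cast Nat.pos_of_ne_zero (NeZero.ne n)
  rw [le_div_iff₀ hn, sum_mul]
  have h1 : ∑ b ∈ defSet n M S, ‖u b‖ ^ 2 * n
      ≤ ∑ b ∈ defSet n M S, (2 * ∑ s ∈ range n, ‖ext (starReg n M S) u (cpt n M b.1 s)‖ ^ 2
          + ∑ r ∈ range n, gI n M S b.1.2 u (cpt n M b.1 r)) :=
    sum_le_sum fun b hb => by rw [mul_comm]; exact spike_le n M S u b ((mem_defSet n M S).mp hb)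
  have h2 : ∑ b ∈ defSet n M S, ∑ s ∈ range n, ‖ext (starReg n M S) u (cpt n M b.1 s)‖ ^ 2 ≤ nsq u := by
    rw [← nsq_ext (starReg n M S) u]
    exact sum_columns_le n M S (fun c => ‖ext (starReg n M S) u c‖ ^ 2) fun c => by positivity
  have h3 : ∑ b ∈ defSet n M S, ∑ r ∈ range n, gI n M S b.1.2 u (cpt n M b.1 r) ≤ ∑ ν, nsq (igrad M S n ν u) := by
    have h3a := sum_columns_le n M S (fun c => gI n M S c.2 u c) fun c => gI_nonneg n M S _ u _
    have h3b : ∑ c : Tor (fine n M) × Fin d, gI n M S c.2 u c ≤ ∑ c : Tor (fine n M) × Fin d, ∑ ν, gI n M S ν u c :=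
      sum_le_sum fun c _ => single_le_sum (f := fun ν => gI n M S ν u c) (fun ν _ => gI_nonneg n M S ν u c) (mem_univ c.2)
    rw [sum_comm] at h3b
    simp only [sum_gI_eq] at h3b
    exact h3a.trans h3b
  rw [sum_add_distrib, ← mul_sum] at h1
  linarith

end Trace

/-! ## §4 The indicator of the deficient bonds and the Green-function bound -/

section Green

variable {d : ℕ} (n : ℕ) [NeZero n] (M : Fin d → ℕ) [hM : ∀ μ, NeZero (M μ)] (S : Tor M → Prop) [DecidablePred S]

/-- **`P_def`**: the diagonal indicator of the DEFICIENT star bonds (inward spikes). [folklore] -/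
def defP : Matrix {b // starReg n M S b} {b // starReg n M S b} ℂ :=
  Matrix.diagonal fun b => if blockReg n M S b.1.1 then 0 else 1

/-- `P_def` acts by truncation to the spikes. [folklore] -/
theorem defP_mulVec (v : {b // starReg n M S b} → ℂ) (b : {b // starReg n M S b}) :
    (defP n M S *ᵥ v) b = if blockReg n M S b.1.1 then 0 else v b := by
  unfold defP; rw [Matrix.mulVec_diagonal]
  by_cases h : blockReg n M S b.1.1
  · rw [if_pos h, if_pos h, zero_mul]
  · rw [if_neg h, if_neg h, one_mul]

/-- `P_defᴴ = P_def`. [folklore] -/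
theorem defP_conjTranspose : (defP n M S)ᴴ = defP n M S := by
  unfold defP; rw [Matrix.diagonal_conjTranspose]
  congr 1; funext b
  by_cases h : blockReg n M S b.1.1
  · simp only [Pi.star_apply, if_pos h, star_zero]
  · simp only [Pi.star_apply, if_neg h, star_one]

/-- `P_def² = P_def`. [folklore] -/
theorem defP_mul_defP : defP n M S * defP n M S = defP n M S := by
  unfold defP; rw [Matrix.diagonal_mul_diagonal]
  congr 1; funext b
  by_cases h : blockReg n M S b.1.1
  · simp only [if_pos h, mul_zero]
  · simp only [if_neg h, mul_one]

/-- `nsq (P_def v) = Σ_{deficient} ‖v b‖²`. [folklore] -/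
theorem nsq_defP_mulVec (v : {b // starReg n M S b} → ℂ) : nsq (defP n M S *ᵥ v) = ∑ b ∈ defSet n M S, ‖v b‖ ^ 2 := by
  unfold nsq
  rw [defSet, sum_filter]
  refine sum_congr rfl fun b _ => ?_
  rw [defP_mulVec]; split_ifs <;> simp

/-- `nsq (P_def v) ≤ nsq v`. [folklore] -/
theorem nsq_defP_mulVec_le (v : {b // starReg n M S b} → ℂ) : nsq (defP n M S *ᵥ v) ≤ nsq v := by
  rw [nsq_defP_mulVec]
  exact sum_le_sum_of_subset_of_nonneg (subset_univ _) fun _ _ _ => by positivity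

/-- `‖P_def‖ ≤ 1`. [folklore] -/
theorem opNorm_defP_le : ‖defP n M S‖ ≤ 1 :=
  opNorm_le_of_sq_le _ zero_le_one fun v => by rw [one_pow, one_mul]; exact nsq_defP_mulVec_le n M S v

/-- `⟨u, P_def v⟩ = ⟨P_def u, v⟩`. [folklore] -/
theorem star_dotProduct_defP_mulVec (u v : {b // starReg n M S b} → ℂ) :
    star u ⬝ᵥ (defP n M S *ᵥ v) = star (defP n M S *ᵥ u) ⬝ᵥ v := by
  rw [Matrix.dotProduct_mulVec, Matrix.star_mulVec, defP_conjTranspose]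

/-- **THE GREEN FUNCTION OF A SPIKE CHARGE IS SMALL**: for `D` coercive (`γ`, W1) with the interior gradient-form bound (`CgI`,
interior W2), `‖D⁻¹·P_def‖ ≤ √((2γ⁻¹ + CgI)·γ⁻¹ / n)`. [folklore] -/
theorem opNorm_inv_mul_defP_le (D : Matrix {b // starReg n M S b} {b // starReg n M S b} ℂ) {γ CgI : ℝ} (hγ : 0 < γ)
    (hCgI : 0 ≤ CgI) (hcoer : Coercive D γ)
    (hI : ∀ w : {b // starReg n M S b} → ℂ, ∑ μ, nsq (igrad M S n μ w) ≤ CgI * (star w ⬝ᵥ (D *ᵥ w)).re) :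
    ‖D⁻¹ * defP n M S‖ ≤ Real.sqrt ((2 * γ⁻¹ + CgI) * γ⁻¹ / n) := by
  have hn : (0 : ℝ) < n := by exact_mod_cast Nat.pos_of_ne_zero (NeZero.ne n)
  set K : ℝ := 2 * γ⁻¹ + CgI with hK
  have hK0 : 0 ≤ K := by positivity
  have hU := isUnit_det_of_coercive hγ hcoer
  refine opNorm_le_of_sq_le _ (Real.sqrt_nonneg _) fun v => ?_
  rw [Real.sq_sqrt (by positivity)]
  -- names
  set χ := defP n M S *ᵥ v with hχ
  set u := D⁻¹ *ᵥ χ with hu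
  have huv : (D⁻¹ * defP n M S) *ᵥ v = u := by rw [hu, hχ, Matrix.mulVec_mulVec]
  have hDu : D *ᵥ u = χ := by rw [hu, Matrix.mulVec_mulVec, Matrix.mul_nonsing_inv D hU, Matrix.one_mulVec]
  set X : ℝ := (star u ⬝ᵥ (D *ᵥ u)).re with hX
  have hcoer_u : γ * nsq u ≤ X := hcoer u
  have hX0 : 0 ≤ X := le_trans (mul_nonneg hγ.le (nsq_nonneg u)) hcoer_u
  -- `X = Re⟨P u, v⟩ ≤ p·q`
  set p := Real.sqrt (nsq (defP n M S *ᵥ u)) with hp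
  set q := Real.sqrt (nsq v) with hq
  have hp0 : 0 ≤ p := Real.sqrt_nonneg _
  have hq0 : 0 ≤ q := Real.sqrt_nonneg _
  have hXpq : X ≤ p * q := by
    rw [hX, hDu, hχ, star_dotProduct_defP_mulVec]
    exact (Complex.re_le_norm _).trans (norm_star_dotProduct_le _ _)
  -- trace: `p² ≤ (K/n)·X`
  have hnsq_u : nsq u ≤ γ⁻¹ * X := by
    rw [le_inv_mul_iff₀' hγ]; linarith [hcoer_u]
  have hp2 : p ^ 2 ≤ K / n * X := by
    rw [hp, Real.sq_sqrt (nsq_nonneg _), nsq_defP_mulVec]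
    calc ∑ b ∈ defSet n M S, ‖u b‖ ^ 2 ≤ (2 * nsq u + ∑ ν, nsq (igrad M S n ν u)) / n := trace_deficient_le n M S u
      _ ≤ (2 * (γ⁻¹ * X) + CgI * X) / n := by gcongr; exact hI u
      _ = K / n * X := by rw [hK]; ring
  -- hence `p ≤ (K/n)·q` and `X ≤ (K/n)·q²`
  have hpq : p ≤ K / n * q := by
    rcases hp0.eq_or_lt with hz | hpos
    · rw [← hz]; positivity
    · have h1 : p * p ≤ (K / n * q) * p := by nlinarith [hp2, hXpq, div_nonneg hK0 hn.le]
      exact le_of_mul_le_mul_right h1 hpos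
  have hXq : X ≤ K / n * q ^ 2 := by nlinarith [hXpq, hpq, div_nonneg hK0 hn.le]
  -- conclusion
  have e1 : ∑ i, ‖∑ j, (D⁻¹ * defP n M S) i j * v j‖ ^ 2 = nsq u := by rw [← huv]; rfl
  have e2 : ∑ j, ‖v j‖ ^ 2 = q ^ 2 := by rw [hq, Real.sq_sqrt (nsq_nonneg _)]; rfl
  rw [e1, e2]
  calc nsq u ≤ γ⁻¹ * X := hnsq_u
    _ ≤ γ⁻¹ * (K / n * q ^ 2) := mul_le_mul_of_nonneg_left hXq (inv_nonneg.mpr hγ.le)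
    _ = K * γ⁻¹ / n * q ^ 2 := by ring

end Green

end Summit.QuantumFields.BalabanUV.T4Continuum.RegionStarTrace

end
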